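import Literature.Geometry.Kaehler.ComplexTorusSimpleCMSurfaceEigenframe
import Literature.Geometry.Kaehler.ComplexTorusAbelianSurfacesNoncommutativeProductHodgeGroup
import Literature.Geometry.Kaehler.ComplexTorusHodgeGroupProductSl2Planes
import Literature.Geometry.Kaehler.ComplexTorusHodgeGroupProductLieAlgebraGoursat
import Literature.LinearAlgebra.CMSurfacePairCocharacterDichotomy
import Literature.NumberTheory.Automorphic.TorusLieAlgebraIntegralSpan
import Literature.NumberTheory.Automorphic.LieAlgebraGLConjReindex
import Literature.NumberTheory.Automorphic.TorusRigidity
import Literature.NumberTheory.Automorphic.ReductiveGLn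
import HarnessLib

/-!
# Moonen–Zarhin Prop. (4.2): `Hg(Y₁ × Y₂) = Hg(Y₁) × Hg(Y₂)` for two non-isogenous simple CM abelian surfaces, and
# condition (D) for EVERY product of two complex abelian surfaces (Thm. (0.1)(4) for `X ∼ Y₁ × Y₂`)

Layer `Literature/Geometry/Kaehler`, namespace `Literature.Geometry.Kaehler.ComplexTorus`; lane `lit-hodgefound` (Track 2
foundations library), Layer A3∕A4; prover seat `lit-hodgefound-p17` (generation 53, self-proposed row g53-#3).  THEOREMS ONLY
(no definition, no instance, no notation, no named fact; D-0026 net debt 0).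

## Source, verbatim

B. Moonen, Yu. G. Zarhin, *Hodge classes on abelian varieties of low dimension*, Math. Ann. 315 (1999) 711–733
[MoonenZarhin1999LowDim], held `paper:arxiv-math_9901113`:
* §4 Prop. (4.2) (p0008 L11–L14): «Let `Y₁` and `Y₂` be simple complex abelian surfaces of CM-type such that `Y₁` and `Y₂` are
  not isogenous. Write `X = Y₁ × Y₂`. Then `Hg(X) = Hg(Y₁) × Hg(Y₂)`; in particular, `B•(Xⁿ) = D•(Xⁿ)` for all `n`.»  Proof
  (p0008 L15–L65): «the torus `U_F` is `ℚ`-simple … `Hg(X) ⊂ Hg(Y₁) × Hg(Y₂)` projects surjectively to both factors … if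
  `Hg(X)` were not the full product, the two character modules would have a common simple quotient, and … this gives a non-zero
  homomorphism `Y₁ → Y₂`, contradiction.»
* §5 (5.5) (p0009 L97–L108): «Suppose then that `Y₁` and `Y₂` are both of CM-type … If `Y₁` and `Y₂` are not isogenous then we
  apply (4.2).» — together with (5.4) (the tree's `ComplexTorusAbelianSurfacesNoncommutativeProductHodgeGroup`, g52) this is
  Thm. (0.1)(4) for `X ∼ Y₁ × Y₂`: «`X` is isogenous to a product of two abelian surfaces ⟹ (D) holds».

## What is proved, and how (deviation from the print recorded)

* **`IsSimple.hodgeGroupC_prod_eq_blockDiagProd_of_hodgeGroup_comm_of_finrank_eq_two`** — Prop. (4.2) on complex points: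
  `Hg(Y₁ × Y₂)(ℂ) = Hg(Y₁)(ℂ) × Hg(Y₂)(ℂ)` for simple polarised abelian surfaces with commutative Hodge groups, `Y₂ ≁ Y₁`.
  PROOF (cocharacter form of Moonen–Zarhin's character-module argument).  By g53-#2 each `Hg(Yᵢ)(ℂ) = Pᵢ 𝕋_{πᵢ} Pᵢ⁻¹` with
  `Lie Hg(Yᵢ)(ℂ) = {Pᵢ diag(z) Pᵢ⁻¹ | z ∘ πᵢ = -z}`.  With `P = P₁ ⊕ P₂`, the subspace
  `L = {z : κ₁ ⊔ κ₂ → ℂ | P diag(z) P⁻¹ ∈ Lie Hg(Y₁ × Y₂)(ℂ)}` is (i) contained in `A₁ × A₂` and surjective onto `A₁`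
  («`Hg(X)` projects surjectively to both factors», the tree's Goursat position `exists_lieHom_toBlocks`), (ii) spanned by its
  INTEGRAL vectors (`Hg(X)(ℂ)` is a torus conjugated by `P` into the diagonal: Springer 4.4.13, the tree's
  `IsTorusSubgroup.exists_integral_diagonal_span_of_le_diagonal` — the cocharacter lattice `X_*(Hg X) ⊗ ℂ = Lie`), (iii) stable
  under `z ↦ z ∘ (g_σ ⊔ g'_σ)` on integral vectors for every `σ ∈ Aut(ℂ)` (`Hg(X)` is defined over `ℚ`: the Galois action on
  `X_*`), and (iv) contains the sign vector `s₁ ⊔ s₂` of `J = J₁ ⊕ J₂ ∈ Lie Hg(X)`.  The pure linear algebra of g53-#1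
  (`CMSurfacePair.forall_mem_or_exists_forall_apply_inr_eq`, fed with the 4-cycles of g53-#2 = «`F` contains no imaginary
  quadratic field») leaves two cases: `L = A₁ × A₂` — then `(W 0; 0 0) ∈ Lie Hg(X)` for all `W ∈ Lie Hg(Y₁)` and the tree's
  `hodgeGroupC_prod_eq_blockDiagProd_of_forall_fromBlocks_zero_mem` splits `Hg(X)`; or `L` is the graph of a matching `β` of
  eigenlines — then `T = P₁ E_β P₂⁻¹ ≠ 0` intertwines `Z₁₁ T = T Z₂₂` on `Lie Hg(X)` and the tree's
  `homRat_ne_bot_of_forall_toBlocks₁₁_mul_eq` («some multiple of `φ` corresponds to an isogeny») gives `Hom⁰(Y₂, Y₁) ≠ 0`,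
  contradicting `IsSimple.homRat_eq_bot`.
* **`IsRiemannForm.forall_divisorClasses_powPeriod_prod_eq_hodgeClasses_of_finrank_eq_two`** and its `IsAbelianVariety` form —
  THM. (0.1)(4) FOR `Y₁ × Y₂`: for ANY two polarised complex abelian surfaces, every power of `Y₁ × Y₂` has its Hodge ring
  generated by divisor classes (g52's reduction `isSimple_and_hodgeGroup_comm_of_exists_divisorClasses_powPeriod_prod_ne…` +
  Prop. (4.2) + (D) for surfaces); **`IsIsogenous.forall_divisorClasses_powPeriod_eq_hodgeClasses_of_prod_of_finrank_eq_two`**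
  — the same for every complex torus `X ∼ Y₁ × Y₂` ((D) is an isogeny invariant).
-/

noncomputable section

open Matrix Module Function

open scoped MatrixGroups

namespace Literature.Geometry.Kaehler

namespace ComplexTorus

open Literature.NumberTheory.Automorphic (IsZConnected IsTorusSubgroup lieAlgebraGL lieSubalgebraGL diagonalSubgroup
  isMulCommutative_diagonalSubgroup isSemisimpleElt_of_mem_diagonalSubgroup mem_diagonalSubgroup_of_apply_eq_zero
  mem_lieAlgebraGL_map_conj_iff_inv_conj_mem mem_lieSubalgebraGL_iff)
open Literature.LinearAlgebra (CMSurfacePair.forall_mem_or_exists_forall_apply_inr_eq)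

/-! ### §0 Plumbing (file-local): block-diagonal frames -/

section Plumbing

variable {ι₁ ι₂ : Type*} [Fintype ι₁] [DecidableEq ι₁] [Fintype ι₂] [DecidableEq ι₂]

/-- `(P₁ ⊕ P₂)⁻¹ = P₁⁻¹ ⊕ P₂⁻¹`. [folklore] -/
private theorem fromBlocks_inv₅₃ {P₁ : Matrix ι₁ ι₁ ℂ} {P₂ : Matrix ι₂ ι₂ ℂ} (hP₁ : IsUnit P₁.det) (hP₂ : IsUnit P₂.det) :
    (fromBlocks P₁ 0 0 P₂)⁻¹ = fromBlocks P₁⁻¹ 0 0 P₂⁻¹ :=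
  Matrix.inv_eq_right_inv (by
    rw [fromBlocks_multiply, Matrix.mul_nonsing_inv _ hP₁, Matrix.mul_nonsing_inv _ hP₂]
    simp only [Matrix.mul_zero, Matrix.zero_mul, add_zero, zero_add, fromBlocks_one])

/-- Conjugating a diagonal matrix by a block-diagonal frame: `(P₁ ⊕ P₂) diag(z₁ ⊔ z₂) (P₁ ⊕ P₂)⁻¹ =
P₁ diag(z₁) P₁⁻¹ ⊕ P₂ diag(z₂) P₂⁻¹`. [folklore] -/
private theorem fromBlocks_conj_diagonal₅₃ {P₁ : Matrix ι₁ ι₁ ℂ} {P₂ : Matrix ι₂ ι₂ ℂ} (hP₁ : IsUnit P₁.det)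
    (hP₂ : IsUnit P₂.det) (z₁ : ι₁ → ℂ) (z₂ : ι₂ → ℂ) :
    fromBlocks P₁ 0 0 P₂ * diagonal (Sum.elim z₁ z₂) * (fromBlocks P₁ 0 0 P₂)⁻¹ =
      fromBlocks (P₁ * diagonal z₁ * P₁⁻¹) 0 0 (P₂ * diagonal z₂ * P₂⁻¹) := by
  rw [fromBlocks_inv₅₃ hP₁ hP₂, ← fromBlocks_diagonal, fromBlocks_multiply, fromBlocks_multiply]
  simp only [Matrix.mul_zero, Matrix.zero_mul, add_zero, zero_add]

/-- `det (P₁ ⊕ P₂)` is a unit. [folklore] -/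
private theorem isUnit_det_fromBlocks₅₃ {P₁ : Matrix ι₁ ι₁ ℂ} {P₂ : Matrix ι₂ ι₂ ℂ} (hP₁ : IsUnit P₁.det)
    (hP₂ : IsUnit P₂.det) : IsUnit (fromBlocks P₁ 0 0 P₂).det := by
  rw [det_fromBlocks_zero₂₁]
  exact hP₁.mul hP₂

variable {ι : Type*} [Fintype ι] [DecidableEq ι] {P : Matrix ι ι ℂ}

/-- `P (P⁻¹ X P) P⁻¹ = X`. [folklore] -/
private theorem mul_inv_conj_inv₅₃' (hP : IsUnit P.det) (X : Matrix ι ι ℂ) : P * (P⁻¹ * X * P) * P⁻¹ = X := by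
  rw [show P * (P⁻¹ * X * P) * P⁻¹ = P * P⁻¹ * X * (P * P⁻¹) by simp only [Matrix.mul_assoc], Matrix.mul_nonsing_inv _ hP,
    Matrix.one_mul, Matrix.mul_one]

/-- `P⁻¹ (P X P⁻¹) P = X`. [folklore] -/
private theorem inv_mul_conj_mul₅₃' (hP : IsUnit P.det) (X : Matrix ι ι ℂ) : P⁻¹ * (P * X * P⁻¹) * P = X := by
  rw [show P⁻¹ * (P * X * P⁻¹) * P = P⁻¹ * P * X * (P⁻¹ * P) by simp only [Matrix.mul_assoc], Matrix.nonsing_inv_mul _ hP,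
    Matrix.one_mul, Matrix.mul_one]

/-- The frame coordinates are unique. [folklore] -/
private theorem conjDiag_injective₅₃' (hP : IsUnit P.det) {c c' : ι → ℂ}
    (h : P * diagonal c * P⁻¹ = P * diagonal c' * P⁻¹) : c = c' := by
  have h' := congrArg (fun X ↦ P⁻¹ * X * P) h
  simp only [inv_mul_conj_mul₅₃' hP] at h'
  exact diagonal_injective h'

/-- Elements of `P 𝕋_π P⁻¹` are `P diag(d) P⁻¹`. [folklore] -/
private theorem exists_coe_eq_conj_diagonal₅₃ {π : ι → ι} (hπ : Involutive π) (hπ' : ∀ j, π j ≠ j) (hP : IsUnit P.det)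
    {H : Subgroup (SpecialLinearGroup ι ℂ)} (hH : H = (pairedDiagTorus hπ hπ').map (conjGLC P hP).toMonoidHom)
    {M : SpecialLinearGroup ι ℂ} (hM : M ∈ H) : ∃ d : ι → ℂ, (M : Matrix ι ι ℂ) = P * diagonal d * P⁻¹ := by
  rw [hH, Subgroup.mem_map_equiv, mem_pairedDiagTorus_iff, coe_conjGLC_symm] at hM
  obtain ⟨d, -, hM⟩ := hM
  exact ⟨d, by rw [← mul_inv_conj_inv₅₃' hP (M : Matrix ι ι ℂ), hM]⟩

end Plumbing

/-! ### §1 Proposition (4.2) -/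

section Surfaces

variable {κ₁ κ₂ : Type} [Fintype κ₁] [DecidableEq κ₁] [Fintype κ₂] [DecidableEq κ₂]
  {E₁ E₂ : Type} [NormedAddCommGroup E₁] [NormedSpace ℂ E₁] [FiniteDimensional ℂ E₁] [NormedAddCommGroup E₂]
  [NormedSpace ℂ E₂] [FiniteDimensional ℂ E₂] {Φ₁ : (κ₁ → ℝ) ≃L[ℝ] E₁} {Φ₂ : (κ₂ → ℝ) ≃L[ℝ] E₂}
  {η₁ : E₁ [⋀^Fin 2]→L[ℝ] ℝ} {η₂ : E₂ [⋀^Fin 2]→L[ℝ] ℝ}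

omit [FiniteDimensional ℂ E₁] [FiniteDimensional ℂ E₂] in
/-- Prop. (4.2) from the eigenframe data of the two factors (g53-#2): the frame-level core of the proof.
[cite: MoonenZarhin1999LowDim, §4 proof of Prop. (4.2) (p0008 L15–L65)] -/
private theorem hodgeGroupC_prod_eq_blockDiagProd_of_frames₅₃ (hX₁ : IsSimple Φ₁) (hX₂ : IsSimple Φ₂)
    (hne : ¬ IsIsogenous Φ₂ Φ₁)
    {π₁ : κ₁ → κ₁} (hπ₁ : Involutive π₁) (hπ₁' : ∀ j, π₁ j ≠ j) {P₁ : Matrix κ₁ κ₁ ℂ} (hP₁ : IsUnit P₁.det) {s₁ : κ₁ → ℂ}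
    (hcard₁ : Fintype.card κ₁ = 4) (hHg₁ : hodgeGroupC Φ₁ = (pairedDiagTorus hπ₁ hπ₁').map (conjGLC P₁ hP₁).toMonoidHom)
    (hLie₁ : ∀ z : κ₁ → ℂ, P₁ * diagonal z * P₁⁻¹ ∈ lieAlgebraGL ((hodgeGroupC Φ₁).map Matrix.SpecialLinearGroup.toGL) ↔
      ∀ j, z (π₁ j) = -z j)
    (hform₁ : ∀ Z ∈ lieAlgebraGL ((hodgeGroupC Φ₁).map Matrix.SpecialLinearGroup.toGL), ∃ z : κ₁ → ℂ,
      Z = P₁ * diagonal z * P₁⁻¹)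
    (hs1₁ : ∀ j, s₁ j = 1 ∨ s₁ j = -1) (hJ₁ : (jMatrix Φ₁).map Complex.ofRealHom = P₁ * diagonal (fun j ↦ Complex.I * s₁ j) * P₁⁻¹)
    (hperm₁ : ∀ σ : ℂ ≃+* ℂ, ∃ g : Equiv.Perm κ₁, (∀ j, g (π₁ j) = π₁ (g j)) ∧
      ∀ z : κ₁ → ℂ, (P₁ * diagonal z * P₁⁻¹).map σ = P₁ * diagonal (fun j ↦ σ (z (g j))) * P₁⁻¹)
    {σ₁ : ℂ ≃+* ℂ} {g₁ : Equiv.Perm κ₁} {j₀ j₀' : κ₁}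
    (hσ₁ : ∀ z : κ₁ → ℂ, (P₁ * diagonal z * P₁⁻¹).map σ₁ = P₁ * diagonal (fun j ↦ σ₁ (z (g₁ j))) * P₁⁻¹)
    (hg₁π : ∀ j, g₁ (π₁ j) = π₁ (g₁ j)) (hj : j₀ ≠ j₀') (hsj₀ : s₁ j₀ = 1) (hsj₀' : s₁ j₀' = 1) (hgj₀ : g₁ j₀ = j₀')
    (hgj₀' : g₁ j₀' = π₁ j₀)
    {π₂ : κ₂ → κ₂} (hπ₂ : Involutive π₂) (hπ₂' : ∀ m, π₂ m ≠ m) {P₂ : Matrix κ₂ κ₂ ℂ} (hP₂ : IsUnit P₂.det) {s₂ : κ₂ → ℂ}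
    (hcard₂ : Fintype.card κ₂ = 4) (hHg₂ : hodgeGroupC Φ₂ = (pairedDiagTorus hπ₂ hπ₂').map (conjGLC P₂ hP₂).toMonoidHom)
    (hLie₂ : ∀ z : κ₂ → ℂ, P₂ * diagonal z * P₂⁻¹ ∈ lieAlgebraGL ((hodgeGroupC Φ₂).map Matrix.SpecialLinearGroup.toGL) ↔
      ∀ m, z (π₂ m) = -z m)
    (hform₂ : ∀ Z ∈ lieAlgebraGL ((hodgeGroupC Φ₂).map Matrix.SpecialLinearGroup.toGL), ∃ z : κ₂ → ℂ,
      Z = P₂ * diagonal z * P₂⁻¹)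
    (hs1₂ : ∀ m, s₂ m = 1 ∨ s₂ m = -1) (hJ₂ : (jMatrix Φ₂).map Complex.ofRealHom = P₂ * diagonal (fun m ↦ Complex.I * s₂ m) * P₂⁻¹)
    (hperm₂ : ∀ σ : ℂ ≃+* ℂ, ∃ g : Equiv.Perm κ₂, (∀ m, g (π₂ m) = π₂ (g m)) ∧
      ∀ z : κ₂ → ℂ, (P₂ * diagonal z * P₂⁻¹).map σ = P₂ * diagonal (fun m ↦ σ (z (g m))) * P₂⁻¹)
    {σ₂ : ℂ ≃+* ℂ} {g₂ : Equiv.Perm κ₂} {m₀ m₀' : κ₂}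
    (hσ₂ : ∀ z : κ₂ → ℂ, (P₂ * diagonal z * P₂⁻¹).map σ₂ = P₂ * diagonal (fun m ↦ σ₂ (z (g₂ m))) * P₂⁻¹)
    (hg₂π : ∀ m, g₂ (π₂ m) = π₂ (g₂ m)) (hm : m₀ ≠ m₀') (hsm₀ : s₂ m₀ = 1) (hsm₀' : s₂ m₀' = 1) (hgm₀ : g₂ m₀ = m₀')
    (hgm₀' : g₂ m₀' = π₂ m₀) :
    hodgeGroupC (prodPeriod Φ₁ Φ₂) = blockDiagProd (hodgeGroupC Φ₁) (hodgeGroupC Φ₂) := by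
  classical
  haveI : Nonempty κ₂ := Fintype.card_pos_iff.1 (by omega)
  -- the groups and the big frame `P = P₁ ⊕ P₂`
  set G := (hodgeGroupC (prodPeriod Φ₁ Φ₂)).map Matrix.SpecialLinearGroup.toGL with hG_def
  set G₁ := (hodgeGroupC Φ₁).map Matrix.SpecialLinearGroup.toGL with hG₁_def
  set G₂ := (hodgeGroupC Φ₂).map Matrix.SpecialLinearGroup.toGL with hG₂_def
  obtain ⟨P, hP_def⟩ : ∃ P : Matrix (κ₁ ⊕ κ₂) (κ₁ ⊕ κ₂) ℂ, P = fromBlocks P₁ 0 0 P₂ := ⟨_, rfl⟩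
  have hP : IsUnit P.det := hP_def ▸ isUnit_det_fromBlocks₅₃ hP₁ hP₂
  have hconj : ∀ (z₁ : κ₁ → ℂ) (z₂ : κ₂ → ℂ), P * diagonal (Sum.elim z₁ z₂) * P⁻¹ =
      fromBlocks (P₁ * diagonal z₁ * P₁⁻¹) 0 0 (P₂ * diagonal z₂ * P₂⁻¹) := fun z₁ z₂ ↦ by
    rw [hP_def, fromBlocks_conj_diagonal₅₃ hP₁ hP₂]
  have hconj' : ∀ z : κ₁ ⊕ κ₂ → ℂ, P * diagonal z * P⁻¹ =
      fromBlocks (P₁ * diagonal (fun j ↦ z (.inl j)) * P₁⁻¹) 0 0 (P₂ * diagonal (fun m ↦ z (.inr m)) * P₂⁻¹) := fun z ↦ by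
    have h := hconj (z ∘ Sum.inl) (z ∘ Sum.inr)
    rw [Sum.elim_comp_inl_inr] at h
    exact h
  -- `L = {z | P diag(z) P⁻¹ ∈ Lie Hg(Y₁ × Y₂)(ℂ)}`
  obtain ⟨L, hL⟩ : ∃ L : Submodule ℂ (κ₁ ⊕ κ₂ → ℂ), ∀ z, z ∈ L ↔ P * diagonal z * P⁻¹ ∈ lieAlgebraGL G :=
    ⟨(lieAlgebraGL G).comap
      { toFun := fun z ↦ P * diagonal z * P⁻¹
        map_add' := fun a b ↦ by
          rw [show diagonal (a + b) = diagonal a + diagonal b from (diagonal_add a b).symm, Matrix.mul_add, Matrix.add_mul]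
        map_smul' := fun c a ↦ by
          rw [RingHom.id_apply, show diagonal (c • a) = c • diagonal a from diagonal_smul c a, Matrix.mul_smul,
            Matrix.smul_mul] },
      fun _ ↦ Iff.rfl⟩
  -- (i) `L ⊆ A₁ × A₂`: the blocks of `P diag(z) P⁻¹ ∈ Lie Hg(X)` lie in `Lie Hg(Y₁)`, `Lie Hg(Y₂)`
  have hLblocks : ∀ z ∈ L, P₁ * diagonal (fun j ↦ z (.inl j)) * P₁⁻¹ ∈ lieAlgebraGL G₁ ∧
      P₂ * diagonal (fun m ↦ z (.inr m)) * P₂⁻¹ ∈ lieAlgebraGL G₂ := fun z hz ↦ by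
    have hZ := (hL z).1 hz
    rw [hconj'] at hZ
    obtain ⟨-, h₁, h₂⟩ := eq_fromBlocks_of_mem_lieAlgebraGL_hodgeGroupC_prod Φ₁ Φ₂ hZ
    rw [toBlocks_fromBlocks₁₁] at h₁
    rw [toBlocks_fromBlocks₂₂] at h₂
    exact ⟨h₁, h₂⟩
  have hL₁ : ∀ z ∈ L, ∀ j, z (.inl (π₁ j)) = -z (.inl j) := fun z hz ↦ (hLie₁ _).1 (hLblocks z hz).1
  have hL₂ : ∀ z ∈ L, ∀ m, z (.inr (π₂ m)) = -z (.inr m) := fun z hz ↦ (hLie₂ _).1 (hLblocks z hz).2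
  -- every element of `Lie Hg(X)(ℂ)` is a `P diag(z₁ ⊔ z₂) P⁻¹`
  have hZform : ∀ Z ∈ lieAlgebraGL G, ∃ (z₁ : κ₁ → ℂ) (z₂ : κ₂ → ℂ), Z = P * diagonal (Sum.elim z₁ z₂) * P⁻¹ ∧
      Z.toBlocks₁₁ = P₁ * diagonal z₁ * P₁⁻¹ ∧ Z.toBlocks₂₂ = P₂ * diagonal z₂ * P₂⁻¹ := fun Z hZ ↦ by
    obtain ⟨hZeq, hZ₁, hZ₂⟩ := eq_fromBlocks_of_mem_lieAlgebraGL_hodgeGroupC_prod Φ₁ Φ₂ hZ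
    obtain ⟨z₁, hz₁⟩ := hform₁ _ hZ₁
    obtain ⟨z₂, hz₂⟩ := hform₂ _ hZ₂
    refine ⟨z₁, z₂, ?_, hz₁, hz₂⟩
    rw [hconj, ← hz₁, ← hz₂]
    exact hZeq
  -- (i') `L → A₁` is onto («`Hg(X)` projects surjectively to both factors», the Goursat position of `Lie Hg(X)`)
  obtain ⟨f, -, hf, -, hfs, -, -⟩ := exists_lieHom_toBlocks Φ₁ Φ₂
  have hsurj₁ : ∀ w : κ₁ → ℂ, (∀ j, w (π₁ j) = -w j) → ∃ z ∈ L, ∀ j, z (.inl j) = w j := fun w hw ↦ by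
    have hW : P₁ * diagonal w * P₁⁻¹ ∈ lieSubalgebraGL G₁ := (mem_lieSubalgebraGL_iff).2 ((hLie₁ w).2 hw)
    obtain ⟨Z, hZ⟩ := hfs ⟨_, hW⟩
    obtain ⟨z₁, z₂, hZeq, hZ₁, -⟩ := hZform Z ((mem_lieSubalgebraGL_iff).1 Z.2)
    have h1 : P₁ * diagonal z₁ * P₁⁻¹ = P₁ * diagonal w * P₁⁻¹ := by
      rw [← hZ₁, ← hf Z, hZ]
    have hz₁w : z₁ = w := conjDiag_injective₅₃' hP₁ h1
    refine ⟨Sum.elim z₁ z₂, (hL _).2 ?_, fun j ↦ by rw [Sum.elim_inl, hz₁w]⟩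
    rw [← hZeq]
    exact (mem_lieSubalgebraGL_iff).1 Z.2
  -- (ii) `L` is spanned by its integral vectors: `Hg(X)(ℂ)` is a torus which `P` conjugates into the diagonal
  obtain ⟨P', hP'P⟩ : ∃ P' : GL (κ₁ ⊕ κ₂) ℂ, (P' : Matrix (κ₁ ⊕ κ₂) (κ₁ ⊕ κ₂) ℂ) = P := ⟨Matrix.nonsingInvUnit P hP, rfl⟩
  have hP'inv : ((P'⁻¹ : GL (κ₁ ⊕ κ₂) ℂ) : Matrix (κ₁ ⊕ κ₂) (κ₁ ⊕ κ₂) ℂ) = P⁻¹ := by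
    rw [Matrix.coe_units_inv, hP'P]
  set T' := G.map (MulAut.conj P'⁻¹ : GL (κ₁ ⊕ κ₂) ℂ →* GL (κ₁ ⊕ κ₂) ℂ) with hT'_def
  have hT'le : T' ≤ diagonalSubgroup (κ₁ ⊕ κ₂) ℂ := by
    rintro _ ⟨x, hx, rfl⟩
    obtain ⟨M, hM, rfl⟩ := Subgroup.mem_map.1 hx
    obtain ⟨A, hA, B, hB, rfl⟩ := exists_eq_blockDiagC_of_mem_hodgeGroupC_prod Φ₁ Φ₂ hM
    obtain ⟨d₁, hd₁⟩ := exists_coe_eq_conj_diagonal₅₃ hπ₁ hπ₁' hP₁ hHg₁ hA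
    obtain ⟨d₂, hd₂⟩ := exists_coe_eq_conj_diagonal₅₃ hπ₂ hπ₂' hP₂ hHg₂ hB
    apply mem_diagonalSubgroup_of_apply_eq_zero
    intro i k hik
    rw [MonoidHom.coe_coe, MulAut.conj_apply, inv_inv, Units.val_mul, Units.val_mul, hP'P, hP'inv,
      Matrix.SpecialLinearGroup.coe_GL_coe_matrix, coe_blockDiagC, hd₁, hd₂, ← hconj, inv_mul_conj_mul₅₃' hP,
      diagonal_apply_ne _ hik]
  have hcommT' : IsMulCommutative ↥T' := ⟨⟨fun a b ↦ Subtype.ext (by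
    have h : (a : GL (κ₁ ⊕ κ₂) ℂ) * b = b * a := congrArg Subtype.val
      ((isMulCommutative_diagonalSubgroup (n := κ₁ ⊕ κ₂) (k := ℂ)).is_comm.comm ⟨a.1, hT'le a.2⟩ ⟨b.1, hT'le b.2⟩)
    exact h)⟩⟩
  have hT' : IsTorusSubgroup T' := ⟨(isZConnected_map_toGL_hodgeGroupC (prodPeriod Φ₁ Φ₂)).map_conj P'⁻¹, hcommT',
    fun t ht ↦ isSemisimpleElt_of_mem_diagonalSubgroup (hT'le ht)⟩
  have hLT : ∀ z : κ₁ ⊕ κ₂ → ℂ, z ∈ L ↔ diagonal z ∈ lieAlgebraGL T' := fun z ↦ by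
    rw [hL, hT'_def, mem_lieAlgebraGL_map_conj_iff_inv_conj_mem, inv_inv, hP'P, hP'inv]
  obtain ⟨r, m, hmLie, hmspan⟩ := hT'.exists_integral_diagonal_span_of_le_diagonal hT'le
  have hint : L ≤ Submodule.span ℂ {z | z ∈ L ∧ ∀ x, ∃ n : ℤ, z x = n} := fun z hz ↦ by
    obtain ⟨c, hc⟩ := hmspan (diagonal z) ((hLT z).1 hz)
    have hz' : z = ∑ i, c i • (fun a ↦ ((m i a : ℤ) : ℂ)) := by
      ext a
      have h := congrFun (congrFun hc a) a
      rw [diagonal_apply_eq, Matrix.sum_apply] at h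
      rw [h, Finset.sum_apply]
      refine Finset.sum_congr rfl fun i _ ↦ ?_
      rw [Matrix.smul_apply, diagonal_apply_eq, Pi.smul_apply]
    rw [hz']
    exact Submodule.sum_mem _ fun i _ ↦ Submodule.smul_mem _ _
      (Submodule.subset_span ⟨(hLT _).2 (hmLie i), fun x ↦ ⟨m i x, rfl⟩⟩)
  -- (iv) the sign vector `s = s₁ ⊔ s₂` of `J = J₁ ⊕ J₂ ∈ Lie Hg(X)` lies in `L`
  obtain ⟨s, hs_def⟩ : ∃ s : κ₁ ⊕ κ₂ → ℂ, s = Sum.elim s₁ s₂ := ⟨_, rfl⟩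
  have hsv : ∀ x, s x = 1 ∨ s x = -1 := by
    rintro (j | m')
    · rw [hs_def, Sum.elim_inl]; exact hs1₁ j
    · rw [hs_def, Sum.elim_inr]; exact hs1₂ m'
  have hs : s ∈ L := by
    have hJ : (jMatrix (prodPeriod Φ₁ Φ₂)).map Complex.ofRealHom ∈ lieAlgebraGL G :=
      (mem_hodgeGroupLieC_iff_mem_lieAlgebraGL (prodPeriod Φ₁ Φ₂)).1 (jMatrix_map_mem_hodgeGroupLieC (prodPeriod Φ₁ Φ₂))
    have hIs : Complex.I • s ∈ L := by
      refine (hL _).2 ?_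
      have h : Complex.I • s = Sum.elim (fun j ↦ Complex.I * s₁ j) (fun m ↦ Complex.I * s₂ m) := by
        ext x
        rcases x with j | m' <;> simp [hs_def]
      rw [h, hconj, ← hJ₁, ← hJ₂]
      rw [jMatrix_prodPeriod, fromBlocks_map, Matrix.map_zero _ (map_zero _)] at hJ
      exact hJ
    exact (Submodule.smul_mem_iff L Complex.I_ne_zero).1 hIs
  -- (iii) `Aut(ℂ)`-stability of `Lie Hg(X)(ℂ)` read on `L`: `z ∘ (g_σ ⊔ g'_σ) ∈ L` for integral `z ∈ L`
  have hstab : ∀ (σ : ℂ ≃+* ℂ) (a₁ : Equiv.Perm κ₁) (a₂ : Equiv.Perm κ₂),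
      (∀ z : κ₁ → ℂ, (P₁ * diagonal z * P₁⁻¹).map σ = P₁ * diagonal (fun j ↦ σ (z (a₁ j))) * P₁⁻¹) →
      (∀ z : κ₂ → ℂ, (P₂ * diagonal z * P₂⁻¹).map σ = P₂ * diagonal (fun j ↦ σ (z (a₂ j))) * P₂⁻¹) →
      ∀ z ∈ L, (∀ x, ∃ n : ℤ, z x = n) → z ∘ Sum.map a₁ a₂ ∈ L := fun σ a₁ a₂ ha₁ ha₂ z hz hzi ↦ by
    have hσz : ∀ x, σ (z x) = z x := fun x ↦ by
      obtain ⟨n, hn⟩ := hzi x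
      rw [hn, map_intCast]
    have hZ := map_mem_lieAlgebraGL_of_forall_map_mem (isAutStableGL_map_toGL_hodgeGroupC (prodPeriod Φ₁ Φ₂)).map_mem σ
      ((hL z).1 hz)
    rw [hconj', fromBlocks_map, ha₁, ha₂, Matrix.map_zero _ (map_zero _), Matrix.map_zero _ (map_zero _)] at hZ
    simp only [hσz] at hZ
    refine (hL _).2 ?_
    rw [hconj']
    exact hZ
  obtain ⟨b₂, -, hb₂⟩ := hperm₂ σ₁
  obtain ⟨b₁, -, hb₁⟩ := hperm₁ σ₂
  -- the dichotomy of g53-#1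
  rcases CMSurfacePair.forall_mem_or_exists_forall_apply_inr_eq hcard₁ hcard₂ hπ₁ hπ₂ hL₁ hL₂ hsurj₁ hint hs hsv
      (hstab σ₁ g₁ b₂ hσ₁ hb₂) hg₁π hj (by rw [hs_def, Sum.elim_inl, hsj₀]) (by rw [hs_def, Sum.elim_inl, hsj₀']) hgj₀ hgj₀'
      (hstab σ₂ b₁ g₂ hb₁ hσ₂) hg₂π hm (by rw [hs_def, Sum.elim_inr, hsm₀]) (by rw [hs_def, Sum.elim_inr, hsm₀']) hgm₀ hgm₀'
    with hall | ⟨β, hβ⟩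
  · -- `L = A₁ × A₂`: `(W 0; 0 0) ∈ Lie Hg(X)` for every `W ∈ Lie Hg(Y₁)`, so `Hg(X)` splits
    refine hodgeGroupC_prod_eq_blockDiagProd_of_forall_fromBlocks_zero_mem Φ₁ Φ₂ fun W hW ↦ ?_
    obtain ⟨w, rfl⟩ := hform₁ W hW
    have hw : ∀ j, w (π₁ j) = -w j := (hLie₁ w).1 hW
    have hz : Sum.elim w (0 : κ₂ → ℂ) ∈ L :=
      hall _ (fun j ↦ by rw [Sum.elim_inl, Sum.elim_inl, hw]) (fun m' ↦ by simp only [Sum.elim_inr, Pi.zero_apply, neg_zero])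
    have hZ := (hL _).1 hz
    rwa [hconj, diagonal_zero', Matrix.mul_zero, Matrix.zero_mul] at hZ
  · -- `L` is the graph of a matching `β`: `T = P₁ E_β P₂⁻¹` intertwines, so `Hom⁰(Y₂, Y₁) ≠ 0` — contradiction
    exfalso
    obtain ⟨B, hB⟩ : ∃ B : Matrix κ₁ κ₂ ℂ, ∀ j m', B j m' = if j = β m' then 1 else 0 := ⟨fun j m' ↦ _, fun _ _ ↦ rfl⟩
    have hBd : ∀ z ∈ L, diagonal (fun j ↦ z (.inl j)) * B = B * diagonal (fun m' ↦ z (.inr m')) := fun z hz ↦ by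
      ext j m'
      rw [diagonal_mul, mul_diagonal, hB, hβ z hz m']
      split_ifs with h
      · rw [h, mul_one, one_mul]
      · rw [mul_zero, zero_mul]
    have hB0 : B ≠ 0 := fun h ↦ by
      obtain ⟨m'⟩ := ‹Nonempty κ₂›
      have h1 := congrFun (congrFun h (β m')) m'
      rw [hB, if_pos rfl, Matrix.zero_apply] at h1
      exact one_ne_zero h1
    refine homRat_ne_bot_of_forall_toBlocks₁₁_mul_eq Φ₁ Φ₂ (T := P₁ * B * P₂⁻¹) (fun h ↦ hB0 ?_) (fun Z hZ ↦ ?_)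
      (hX₂.homRat_eq_bot hX₁ hne)
    · have h' := congrArg (fun X ↦ P₁⁻¹ * X * P₂) h
      simp only [Matrix.mul_zero, Matrix.zero_mul] at h'
      rw [← h', ← Matrix.mul_assoc, ← Matrix.mul_assoc, Matrix.nonsing_inv_mul _ hP₁, Matrix.one_mul, Matrix.mul_assoc,
        Matrix.nonsing_inv_mul _ hP₂, Matrix.mul_one]
    · obtain ⟨z₁, z₂, hZeq, hZ₁, hZ₂⟩ := hZform Z hZ
      have hz : Sum.elim z₁ z₂ ∈ L := (hL _).2 (hZeq ▸ hZ)
      have h := hBd _ hz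
      simp only [Sum.elim_inl, Sum.elim_inr] at h
      rw [hZ₁, hZ₂, show P₁ * diagonal z₁ * P₁⁻¹ * (P₁ * B * P₂⁻¹) = P₁ * (diagonal (fun j ↦ z₁ j) * B) * P₂⁻¹ by
        rw [show diagonal (fun j ↦ z₁ j) = diagonal z₁ from rfl]
        simp only [Matrix.mul_assoc, Matrix.nonsing_inv_mul_cancel_left _ _ hP₁],
        h, show P₁ * B * P₂⁻¹ * (P₂ * diagonal z₂ * P₂⁻¹) = P₁ * (B * diagonal fun m' ↦ z₂ m') * P₂⁻¹ by
        rw [show diagonal (fun m' ↦ z₂ m') = diagonal z₂ from rfl]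
        simp only [Matrix.mul_assoc, Matrix.nonsing_inv_mul_cancel_left _ _ hP₂]]

/-- **MOONEN–ZARHIN PROPOSITION (4.2): `Hg(Y₁ × Y₂) = Hg(Y₁) × Hg(Y₂)` FOR TWO NON-ISOGENOUS SIMPLE ABELIAN SURFACES OF CM
TYPE** (complex points; `Yᵢ = Eᵢ ∕ Φᵢ(ℤ^κᵢ)` simple polarised abelian surfaces with commutative Hodge groups, `Y₂ ≁ Y₁` —
this includes the case of different CM fields used in (5.5)).  «Let `Y₁` and `Y₂` be simple complex abelian surfaces of CM-type
such that `Y₁` and `Y₂` are not isogenous. Write `X = Y₁ × Y₂`. Then `Hg(X) = Hg(Y₁) × Hg(Y₂)`.»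
[cite: MoonenZarhin1999LowDim, §4 Prop. (4.2) and its proof (p0008 L11–L65), §4 (4.1) (p0008 L1–L7), §3 Lemma (3.4)–(3.5)]
[cite: Springer1998, 4.4.13 and 3.2.10 (4)] [cite: Borel1991, §8.11] -/
theorem IsSimple.hodgeGroupC_prod_eq_blockDiagProd_of_hodgeGroup_comm_of_finrank_eq_two (hX₁ : IsSimple Φ₁)
    (hX₂ : IsSimple Φ₂) (hη₁ : IsRiemannForm Φ₁ η₁) (hη₂ : IsRiemannForm Φ₂ η₂) (h2₁ : finrank ℂ E₁ = 2)
    (h2₂ : finrank ℂ E₂ = 2) (hne : ¬ IsIsogenous Φ₂ Φ₁) (hc₁ : ∀ M ∈ hodgeGroup Φ₁, ∀ N ∈ hodgeGroup Φ₁, M * N = N * M)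
    (hc₂ : ∀ M ∈ hodgeGroup Φ₂, ∀ N ∈ hodgeGroup Φ₂, M * N = N * M) :
    hodgeGroupC (prodPeriod Φ₁ Φ₂) = blockDiagProd (hodgeGroupC Φ₁) (hodgeGroupC Φ₂) := by
  obtain ⟨π₁, hπ₁, hπ₁', P₁, hP₁, s₁, hcard₁, hHg₁, hLie₁, hform₁, hs1₁, -, hJ₁, hperm₁, σ₁, g₁, j₀, j₀', hσ₁, hg₁π, hj,
    hsj₀, hsj₀', hgj₀, hgj₀'⟩ := hX₁.exists_cmEigenframe_of_hodgeGroup_comm_of_finrank_eq_two hη₁ h2₁ hc₁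
  obtain ⟨π₂, hπ₂, hπ₂', P₂, hP₂, s₂, hcard₂, hHg₂, hLie₂, hform₂, hs1₂, -, hJ₂, hperm₂, σ₂, g₂, m₀, m₀', hσ₂, hg₂π, hm,
    hsm₀, hsm₀', hgm₀, hgm₀'⟩ := hX₂.exists_cmEigenframe_of_hodgeGroup_comm_of_finrank_eq_two hη₂ h2₂ hc₂
  exact hodgeGroupC_prod_eq_blockDiagProd_of_frames₅₃ hX₁ hX₂ hne hπ₁ hπ₁' hP₁ hcard₁ hHg₁ hLie₁ hform₁ hs1₁ hJ₁ hperm₁ hσ₁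
    hg₁π hj hsj₀ hsj₀' hgj₀ hgj₀' hπ₂ hπ₂' hP₂ hcard₂ hHg₂ hLie₂ hform₂ hs1₂ hJ₂ hperm₂ hσ₂ hg₂π hm hsm₀ hsm₀' hgm₀ hgm₀'

/-! ### §2 Theorem (0.1)(4) for `X ∼ Y₁ × Y₂`: condition (D) for every product of two abelian surfaces -/

/-- **MOONEN–ZARHIN THM. (0.1)(4) FOR `Y₁ × Y₂`: EVERY PRODUCT OF TWO POLARISED COMPLEX ABELIAN SURFACES SATISFIES CONDITION
(D)** — for all `k`, `p`, the Hodge classes of `(Y₁ × Y₂)^k` in degree `2p` are generated by divisor classes («`X` is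
isogenous to a product of two abelian surfaces ⟹ `B• = D•`»: (5.4) outside CM × CM, the tree's g52 assembly; (5.5) = Prop.
(4.2) for two non-isogenous simple CM surfaces, §1; (D) for each surface, the tree's
`IsAbelianVariety.forall_divisorClasses_powPeriod_eq_hodgeClasses_of_finrank_eq_two`).
[cite: MoonenZarhin1999LowDim, Thm. (0.1)(4) (p0001 L131–L135), §4 Prop. (4.2), §5 (5.4)–(5.5) (p0009 L82–L108)] -/
theorem IsRiemannForm.forall_divisorClasses_powPeriod_prod_eq_hodgeClasses_of_finrank_eq_two (hη₁ : IsRiemannForm Φ₁ η₁)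
    (hη₂ : IsRiemannForm Φ₂ η₂) (h2₁ : finrank ℂ E₁ = 2) (h2₂ : finrank ℂ E₂ = 2) :
    ∀ k p, divisorClasses (powPeriod (prodPeriod Φ₁ Φ₂) k) p = hodgeClasses (powPeriod (prodPeriod Φ₁ Φ₂) k) p := by
  haveI : Nonempty κ₁ := Fintype.card_pos_iff.1 (by rw [card_eq_two_mul_finrank Φ₁, h2₁]; norm_num)
  haveI : Nonempty κ₂ := Fintype.card_pos_iff.1 (by rw [card_eq_two_mul_finrank Φ₂, h2₂]; norm_num)
  by_contra h
  push Not at h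
  obtain ⟨hX₁, hX₂, hne, -, -, hc₁, hc₂⟩ :=
    hη₁.isSimple_and_hodgeGroup_comm_of_exists_divisorClasses_powPeriod_prod_ne_of_finrank_eq_two hη₂ h2₁ h2₂ h
  obtain ⟨k, p, hkp⟩ := h
  exact hkp (forall_divisorClasses_powPeriod_prod_eq_hodgeClasses_of_hodgeGroupC_prod_eq
    (hX₁.hodgeGroupC_prod_eq_blockDiagProd_of_hodgeGroup_comm_of_finrank_eq_two hX₂ hη₁ hη₂ h2₁ h2₂ hne hc₁ hc₂)
    (IsAbelianVariety.forall_divisorClasses_powPeriod_eq_hodgeClasses_of_finrank_eq_two ⟨η₁, hη₁⟩ h2₁)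
    (IsAbelianVariety.forall_divisorClasses_powPeriod_eq_hodgeClasses_of_finrank_eq_two ⟨η₂, hη₂⟩ h2₂) k p)

/-- `IsAbelianVariety` form of Thm. (0.1)(4) for `Y₁ × Y₂`: every product of two complex abelian surfaces satisfies (D).
[cite: MoonenZarhin1999LowDim, Thm. (0.1)(4), §4 Prop. (4.2), §5 (5.4)–(5.5)] -/
theorem IsAbelianVariety.forall_divisorClasses_powPeriod_prod_eq_hodgeClasses_of_finrank_eq_two (hA₁ : IsAbelianVariety Φ₁)
    (hA₂ : IsAbelianVariety Φ₂) (h2₁ : finrank ℂ E₁ = 2) (h2₂ : finrank ℂ E₂ = 2) :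
    ∀ k p, divisorClasses (powPeriod (prodPeriod Φ₁ Φ₂) k) p = hodgeClasses (powPeriod (prodPeriod Φ₁ Φ₂) k) p := by
  obtain ⟨η₁, hη₁⟩ := hA₁
  obtain ⟨η₂, hη₂⟩ := hA₂
  exact hη₁.forall_divisorClasses_powPeriod_prod_eq_hodgeClasses_of_finrank_eq_two hη₂ h2₁ h2₂

end Surfaces

/-! ### §3 `X ∼ Y₁ × Y₂` -/

section IsogenousToProduct

variable {ι : Type*} [Fintype ι] [DecidableEq ι] {F : Type*} [NormedAddCommGroup F] [NormedSpace ℂ F]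
  {Φ : (ι → ℝ) ≃L[ℝ] F}
  {κ₁ κ₂ : Type} [Fintype κ₁] [Fintype κ₂] [DecidableEq κ₁] [DecidableEq κ₂] {E₁ E₂ : Type}
  [NormedAddCommGroup E₁] [NormedSpace ℂ E₁] [FiniteDimensional ℂ E₁] [NormedAddCommGroup E₂] [NormedSpace ℂ E₂]
  [FiniteDimensional ℂ E₂] {Ψ₁ : (κ₁ → ℝ) ≃L[ℝ] E₁} {Ψ₂ : (κ₂ → ℝ) ≃L[ℝ] E₂} {η₁ : E₁ [⋀^Fin 2]→L[ℝ] ℝ}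
  {η₂ : E₂ [⋀^Fin 2]→L[ℝ] ℝ}

/-- **MOONEN–ZARHIN THM. (0.1)(4): a complex torus ISOGENOUS to a product `Y₁ × Y₂` of two polarised abelian surfaces
satisfies condition (D)** («Let `X` be a complex abelian variety with `dim X ≤ 5` which does not satisfy condition (D). Then
… (4) `X` is simple or is isogenous to `T × E` as in (a)» — so `X ∼ Y₁ × Y₂` satisfies (D); (D) is an isogeny invariant).
[cite: MoonenZarhin1999LowDim, Thm. (0.1)(4) (p0001 L131–L135) and §5 (5.4)–(5.5) (p0009 L82–L108)] -/
theorem IsIsogenous.forall_divisorClasses_powPeriod_eq_hodgeClasses_of_prod_of_finrank_eq_two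
    (hiso : IsIsogenous Φ (prodPeriod Ψ₁ Ψ₂)) (hη₁ : IsRiemannForm Ψ₁ η₁) (hη₂ : IsRiemannForm Ψ₂ η₂)
    (h2₁ : finrank ℂ E₁ = 2) (h2₂ : finrank ℂ E₂ = 2) :
    ∀ k p, divisorClasses (powPeriod Φ k) p = hodgeClasses (powPeriod Φ k) p :=
  hiso.forall_powPeriod_divisorClasses_eq_hodgeClasses_iff.2
    (hη₁.forall_divisorClasses_powPeriod_prod_eq_hodgeClasses_of_finrank_eq_two hη₂ h2₁ h2₂)

end IsogenousToProduct

end ComplexTorus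

end Literature.Geometry.Kaehler
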